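import Literature.Analysis.FluidPDE.ElgindiDthetaAngOp
import Literature.Analysis.FluidPDE.ElgindiDzStirling
import Literature.Analysis.FluidPDE.ElgindiWordTranspose
import HarnessLib

/-!
# Sup bounds for the words of a `𝓦^{4,∞}` function
([ElgindiGhoulMasmoudi2021] §9 Proposition 9.3: "whenever derivatives fall onto `g` we can take them out of the integral")

Topic `Literature/Analysis/FluidPDE`. Support file (definitions with bodies and proved theorems, no
named facts) on the proof path of the named fact
`Literature.Analysis.FluidPDE.Elgindi.ElgindiGhoulMasmoudi2021_stabilityCore`
(`ElgindiStabilityDecomposition.lean`). T. M. Elgindi, T.-E. Ghoul, N. Masmoudi, Camb. J. Math. 9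
(2021) = arXiv:1910.14071, §1.7 (p. 6) and §9 Proposition 9.3 (p. 20).

For `f` smooth on the open strip, the words `D_θ^iD_z^j f` (`i + j ≤ 4`) are finite combinations of
the `𝓦^{4,∞}` terms: `D_z^j f = Σ_n S(j,n) z^n ∂_z^n f` (`ElgindiDzStirling.lean`),
`D_θ^i = Σ_m c_{i,m}(θ)A^m` with `|c_{i,m}| ≤ C·(γ − 1 + sin 2θ)` (`ElgindiDthetaAngOp.lean`), and
`A^m`, `∂_z^n` commute on the strip (`ElgindiWkWords.lean`). Hence, almost everywhere on the strip,
`|D_z^j f| ≤ C·M` and, for `i ≥ 1`, `|D_θ^iD_z^j f| ≤ C·(γ − 1 + sin 2θ)·M` whenever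
`|f|_{𝓦^{4,∞}} ≤ M` (`ae_abs_word_le_of_eWkNorm_le`).
-/

noncomputable section

open MeasureTheory Set Function Real Filter Finset
open _root_.Topology
open scoped ENNReal ContDiff

namespace Literature.Analysis.FluidPDE

namespace Elgindi

/-! ### Locality and linearity of `A_γ^m` on the strip -/

/-- `A_γ` is local on the strip. [folklore] -/
theorem angOpW_congr (α : ℝ) {f g : ℝ → ℝ → ℝ} (h : ∀ p ∈ strip, f p.1 p.2 = g p.1 p.2) {p : ℝ × ℝ} (hp : p ∈ strip) :
    angOpW α f p.1 p.2 = angOpW α g p.1 p.2 := by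
  rw [angOpW_eq, angOpW_eq, dθ_congr h hp]

/-- `A_γ^m` is local on the strip. [folklore] -/
theorem iterate_angOpW_congr (α : ℝ) {f g : ℝ → ℝ → ℝ} (h : ∀ p ∈ strip, f p.1 p.2 = g p.1 p.2) (m : ℕ) :
    ∀ p ∈ strip, ((angOpW α)^[m] f) p.1 p.2 = ((angOpW α)^[m] g) p.1 p.2 := by
  induction m generalizing f g with
  | zero => exact h
  | succ m ih =>
    intro p hp
    rw [Function.iterate_succ_apply', Function.iterate_succ_apply']
    exact angOpW_congr α (ih h) hp

/-- `A_γ^m` of a finite sum of strip-smooth functions, on the strip. [folklore] -/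
theorem iterate_angOpW_finsetSum {α : ℝ} (hα : 0 < α) {ι : Type*} (s : Finset ι) {F : ι → ℝ → ℝ → ℝ}
    (hF : ∀ i ∈ s, ContDiffOn ℝ ∞ (uncurry (F i)) strip) (m : ℕ) :
    ∀ p ∈ strip, ((angOpW α)^[m] fun z θ => ∑ i ∈ s, F i z θ) p.1 p.2 = ∑ i ∈ s, ((angOpW α)^[m] (F i)) p.1 p.2 := by
  induction m with
  | zero => intro p _; simp
  | succ m ih =>
    intro p hp
    rw [Function.iterate_succ_apply']
    have hsm : ∀ i ∈ s, ContDiffOn ℝ ∞ (uncurry ((angOpW α)^[m] (F i))) strip := fun i hi => contDiffOn_iterate_angOpW_strip hα (hF i hi) m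
    rw [angOpW_congr α (g := fun z θ => ∑ i ∈ s, ((angOpW α)^[m] (F i)) z θ) ih hp, angOpW_eq]
    -- `∂_θ` of the finite sum via `HasDerivAt.sum`
    have hd : ∀ i ∈ s, HasDerivAt (fun θ' => ((angOpW α)^[m] (F i)) p.1 θ') (dθ ((angOpW α)^[m] (F i)) p.1 p.2) p.2 :=
      fun i hi => hasDerivAt_dθ_strip' (hsm i hi) hp
    have hsum : HasDerivAt (fun θ' => ∑ i ∈ s, ((angOpW α)^[m] (F i)) p.1 θ') (∑ i ∈ s, dθ ((angOpW α)^[m] (F i)) p.1 p.2) p.2 := by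
      have h := HasDerivAt.sum hd
      have e : (∑ i ∈ s, fun θ' => ((angOpW α)^[m] (F i)) p.1 θ') = fun θ' => ∑ i ∈ s, ((angOpW α)^[m] (F i)) p.1 θ' := by
        funext θ'; simp [Finset.sum_apply]
      rwa [e] at h
    have edθ : dθ (fun z θ => ∑ i ∈ s, ((angOpW α)^[m] (F i)) z θ) p.1 p.2 = ∑ i ∈ s, dθ ((angOpW α)^[m] (F i)) p.1 p.2 := hsum.deriv
    rw [edθ, mul_sum]
    refine sum_congr rfl fun i _ => ?_
    rw [Function.iterate_succ_apply', angOpW_eq]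
where
  /-- the `θ`-slice derivative of a strip-smooth function (local copy of the pattern) -/
  hasDerivAt_dθ_strip' {u : ℝ → ℝ → ℝ} (hu : ContDiffOn ℝ ∞ (uncurry u) strip) {p : ℝ × ℝ} (hp : p ∈ strip) :
      HasDerivAt (fun θ' => u p.1 θ') (dθ u p.1 p.2) p.2 := by
    have hu1 : ContDiffOn ℝ 1 (uncurry u) strip := hu.of_le (by exact_mod_cast le_top)
    have := hasDerivAt_slice_snd (differentiableAt_of_contDiffOn_strip hu1 one_ne_zero hp)
    rwa [← dθ_eq_fderiv (differentiableAt_of_contDiffOn_strip hu1 one_ne_zero hp)] at this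

/-- `A_γ^m` passes through the radial multiplier `z^n` (pointwise, no hypotheses). [folklore] -/
theorem iterate_angOpW_zpow_mul (α : ℝ) (c : ℝ) (n m : ℕ) (g : ℝ → ℝ → ℝ) (z θ : ℝ) :
    ((angOpW α)^[m] fun z θ => c * z ^ n * g z θ) z θ = c * z ^ n * ((angOpW α)^[m] g) z θ := by
  induction m generalizing g with
  | zero => rfl
  | succ m ih =>
    rw [Function.iterate_succ_apply, Function.iterate_succ_apply]
    have e : angOpW α (fun z θ => c * z ^ n * g z θ) = fun z θ => c * z ^ n * angOpW α g z θ := by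
      funext z' θ'
      exact angOpW_radialMul α (fun z => c * z ^ n) g z' θ'
    rw [e, ih]

/-! ### The representation of the words -/

/-- **`A^m D_z^j f = Σ_n S(j,n)·z^n·∂_z^n A^m f`** on the strip. [folklore] -/
theorem iterate_angOpW_iterate_Dz {α : ℝ} (hα : 0 < α) {f : ℝ → ℝ → ℝ} (hf : ContDiffOn ℝ ∞ (uncurry f) strip) (m j : ℕ)
    {p : ℝ × ℝ} (hp : p ∈ strip) :
    ((angOpW α)^[m] (Dz^[j] f)) p.1 p.2 = ∑ n ∈ range (j + 1), (stir j n : ℝ) * p.1 ^ n * (dz^[n] ((angOpW α)^[m] f)) p.1 p.2 := by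
  have hterms : ∀ n ∈ range (j + 1), ContDiffOn ℝ ∞ (uncurry fun z θ => (stir j n : ℝ) * z ^ n * (dz^[n] f) z θ) strip :=
    fun n _ => contDiffOn_stirTerm hf _ n
  rw [iterate_angOpW_congr α (g := fun z θ => ∑ n ∈ range (j + 1), (stir j n : ℝ) * z ^ n * (dz^[n] f) z θ)
      (iterate_Dz_eq_sum_stirling hf j) m p hp, iterate_angOpW_finsetSum hα _ hterms m p hp]
  refine sum_congr rfl fun n _ => ?_
  rw [iterate_angOpW_zpow_mul, iterate_dz_iterate_angOpW_strip hα hf n m p hp]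

/-! ### The a.e. bound on the `𝓦^{4,∞}` terms -/

/-- From `|f|_{𝓦^{4,∞}} ≤ M`: a.e. on the strip, all terms `|wkTerm n m f| ≤ M` (`n + m ≤ 4`). [folklore] -/
theorem ae_abs_wkTerm_le_of_le (α : ℝ) (f : ℝ → ℝ → ℝ) {M : ℝ} (hM0 : 0 ≤ M) (hM : eWkNorm α 4 f ≤ ENNReal.ofReal M) :
    ∀ᵐ p ∂(volume.restrict strip), ∀ n m : ℕ, n + m ≤ 4 → |wkTerm α n m f p.1 p.2| ≤ M := by
  refine ae_all_iff.2 fun n => ae_all_iff.2 fun m => ?_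
  by_cases h : n + m ≤ 4
  · filter_upwards [ae_abs_wkTerm_le α h f] with p hp
    intro _
    exact (ENNReal.ofReal_le_ofReal_iff hM0).1 (hp.trans hM)
  · exact ae_of_all _ fun p hnm => absurd hnm h

/-- On the strip: `|z^n ∂_z^n A^m f| ≤ M` when `|wkTerm n m f| ≤ M` (`z^n ≤ (z+1)^n`, `sin(2θ)^{α/5} ≤ 1`). [folklore] -/
theorem abs_zpow_dz_iterA_le {α : ℝ} (hα : 0 ≤ α) (f : ℝ → ℝ → ℝ) (n m : ℕ) {M : ℝ} {p : ℝ × ℝ} (hp : p ∈ strip)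
    (h : |wkTerm α n m f p.1 p.2| ≤ M) : |p.1 ^ n * (dz^[n] ((angOpW α)^[m] f)) p.1 p.2| ≤ M := by
  have hz : 0 < p.1 := hp.1
  have hs : 0 < Real.sin (2 * p.2) := Real.sin_pos_of_pos_of_lt_pi (by linarith [hp.2.1]) (by linarith [hp.2.2])
  have hs1 : Real.sin (2 * p.2) ^ (-(α / 5)) ≥ 1 :=
    Real.one_le_rpow_of_pos_of_le_one_of_nonpos hs (Real.sin_le_one _) (by linarith)
  have hM : 0 ≤ M := le_trans (abs_nonneg _) h
  rw [wkTerm_apply, abs_mul, abs_mul] at h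
  rw [abs_mul]
  have h1 : |p.1 ^ n| ≤ |(p.1 + 1) ^ n| := by
    rw [abs_of_nonneg (pow_nonneg hz.le _), abs_of_nonneg (pow_nonneg (by linarith) _)]
    exact pow_le_add_one_pow hz n
  have hD := abs_nonneg ((dz^[n] ((angOpW α)^[m] f)) p.1 p.2)
  calc |p.1 ^ n| * |(dz^[n] ((angOpW α)^[m] f)) p.1 p.2| ≤ |(p.1 + 1) ^ n| * |(dz^[n] ((angOpW α)^[m] f)) p.1 p.2| * 1 := by
        rw [mul_one]; exact mul_le_mul_of_nonneg_right h1 hD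
    _ ≤ |(p.1 + 1) ^ n| * |(dz^[n] ((angOpW α)^[m] f)) p.1 p.2| * |Real.sin (2 * p.2) ^ (-(α / 5))| := by
        refine mul_le_mul_of_nonneg_left ?_ (mul_nonneg (abs_nonneg _) hD)
        rw [abs_of_nonneg (Real.rpow_nonneg hs.le _)]; exact hs1
    _ ≤ M := h

/-- The crude combinatorial constant `Σ_{n ≤ 4} S(j,n) ≤ 5·5⁴`. [folklore] -/
theorem sum_stir_le (j : ℕ) (hj : j ≤ 4) : ∑ n ∈ range (j + 1), (stir j n : ℝ) ≤ 5 * 5 ^ 4 := by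
  calc ∑ n ∈ range (j + 1), (stir j n : ℝ) ≤ ∑ _n ∈ range (j + 1), ((j + 1 : ℕ) : ℝ) ^ j := by
        refine sum_le_sum fun n _ => ?_
        exact_mod_cast stir_le j n
    _ = (j + 1 : ℕ) * ((j + 1 : ℕ) : ℝ) ^ j := by rw [sum_const, card_range, nsmul_eq_mul]
    _ ≤ 5 * 5 ^ 4 := by
        have h1 : ((j + 1 : ℕ) : ℝ) ≤ 5 := by exact_mod_cast (by omega : j + 1 ≤ 5)
        have h0 : (0:ℝ) ≤ ((j + 1 : ℕ) : ℝ) := by positivity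
        calc ((j + 1 : ℕ) : ℝ) * ((j + 1 : ℕ) : ℝ) ^ j ≤ 5 * 5 ^ j := by gcongr
          _ ≤ 5 * 5 ^ 4 := by
              gcongr
              · norm_num

/-- **`|A^m D_z^j f| ≤ 5⁵·M`** on the strip, at points where all `𝓦`-terms are `≤ M` (`m + j ≤ 4`). [cite: ElgindiGhoulMasmoudi2021, §9 Proposition 9.3 (p. 20 of arXiv:1910.14071)] -/
theorem abs_iterA_iterDz_le {α : ℝ} (hα : 0 < α) {f : ℝ → ℝ → ℝ} (hf : ContDiffOn ℝ ∞ (uncurry f) strip) {m j : ℕ} (hmj : m + j ≤ 4)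
    {M : ℝ} {p : ℝ × ℝ} (hp : p ∈ strip) (h : ∀ n m : ℕ, n + m ≤ 4 → |wkTerm α n m f p.1 p.2| ≤ M) :
    |((angOpW α)^[m] (Dz^[j] f)) p.1 p.2| ≤ 5 * 5 ^ 4 * M := by
  have hM : 0 ≤ M := le_trans (abs_nonneg _) (h 0 0 (by norm_num))
  rw [iterate_angOpW_iterate_Dz hα hf m j hp]
  refine (abs_sum_le_sum_abs _ _).trans ?_
  calc ∑ n ∈ range (j + 1), |(stir j n : ℝ) * p.1 ^ n * (dz^[n] ((angOpW α)^[m] f)) p.1 p.2|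
      ≤ ∑ n ∈ range (j + 1), (stir j n : ℝ) * M := by
        refine sum_le_sum fun n hn => ?_
        rw [mul_assoc, abs_mul, abs_of_nonneg (by positivity : (0:ℝ) ≤ stir j n)]
        refine mul_le_mul_of_nonneg_left (abs_zpow_dz_iterA_le hα.le f n m hp (h n m ?_)) (by positivity)
        have := mem_range.1 hn; omega
    _ = (∑ n ∈ range (j + 1), (stir j n : ℝ)) * M := by rw [sum_mul]
    _ ≤ 5 * 5 ^ 4 * M := mul_le_mul_of_nonneg_right (sum_stir_le j (by omega)) hM

/-! ### The word bounds -/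

/-- `|a + b + c + d| ≤ |a| + |b| + |c| + |d|` (private helper; public copies exist elsewhere in Literature). [folklore] -/
private theorem abs_add_four_le' (a b c d : ℝ) : |a + b + c + d| ≤ |a| + |b| + |c| + |d| := by
  linarith [abs_add_le (a + b + c) d, abs_add_three a b c]

/-- The constant of the word bounds. [folklore] -/
def wkSupC : ℝ := 148 * (5 * 5 ^ 4)

/-- `0 ≤ q ≤ 2` on `(0, π/2)` for `0 < α ≤ 10`. [folklore] -/
theorem qW_mem {α : ℝ} (hα : 0 < α) (hα10 : α ≤ 10) {θ : ℝ} (hθ : θ ∈ Ioo 0 (π / 2)) : qW α θ ∈ Icc (0:ℝ) 2 := by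
  have hs : 0 < Real.sin (2 * θ) := Real.sin_pos_of_pos_of_lt_pi (by linarith [hθ.1]) (by linarith [hθ.2])
  unfold qW gammaExp
  constructor <;> nlinarith [Real.sin_le_one (2 * θ)]

set_option maxHeartbeats 1600000 in
/-- **A.e. sup bounds for the words of a `𝓦^{4,∞}` function**: if `|f|_{𝓦^{4,∞}} ≤ M` then a.e. on
the strip `|D_z^j f| ≤ C·M` and `|D_θ^iD_z^j f| ≤ C·(γ − 1 + sin 2θ)·M` for `i ≥ 1`, `i + j ≤ 4`. [cite: ElgindiGhoulMasmoudi2021, §9 Proposition 9.3 (p. 20 of arXiv:1910.14071)] -/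
theorem ae_abs_word_le_of_eWkNorm_le {α : ℝ} (hα : 0 < α) (hα10 : α ≤ 10) {f : ℝ → ℝ → ℝ} (hf : ContDiffOn ℝ ∞ (uncurry f) strip)
    {M : ℝ} (hM0 : 0 ≤ M) (hM : eWkNorm α 4 f ≤ ENNReal.ofReal M) :
    ∀ᵐ p ∂(volume.restrict strip), ∀ i j : ℕ, i + j ≤ 4 →
      |(Dθ^[i] (Dz^[j] f)) p.1 p.2| ≤ wkSupC * (if i = 0 then 1 else qW α p.2) * M := by
  filter_upwards [ae_abs_wkTerm_le_of_le α f hM0 hM, ae_restrict_mem measurableSet_strip] with p hwk hp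
  intro i j hij
  have hs : 0 < Real.sin (2 * p.2) := Real.sin_pos_of_pos_of_lt_pi (by linarith [hp.2.1]) (by linarith [hp.2.2])
  have hs1 : Real.sin (2 * p.2) ≤ 1 := Real.sin_le_one _
  have hc1 : |Real.cos (2 * p.2)| ≤ 1 := Real.abs_cos_le_one _
  obtain ⟨hq0, hq2⟩ := qW_mem hα hα10 hp.2
  have hsq : Real.sin (2 * p.2) ≤ qW α p.2 := by unfold qW gammaExp; nlinarith
  set g : ℝ → ℝ → ℝ := Dz^[j] f with hg
  have hgs : ContDiffOn ℝ ∞ (uncurry g) strip := contDiffOn_iterate_Dz_strip_infty hf j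
  -- `|A^m g| ≤ 5⁵ M` for `m ≤ i`
  have hA : ∀ m, m + j ≤ 4 → |((angOpW α)^[m] g) p.1 p.2| ≤ 5 * 5 ^ 4 * M := fun m hm => abs_iterA_iterDz_le hα hf hm hp hwk
  set K : ℝ := 5 * 5 ^ 4 * M with hK
  have hK0 : 0 ≤ K := by positivity
  set s := Real.sin (2 * p.2) with hsdef
  set c := Real.cos (2 * p.2) with hcdef
  set q := qW α p.2 with hqdef
  have hsabs : |s| ≤ 1 := by rw [abs_of_pos hs]; exact hs1
  rcases Nat.eq_zero_or_pos i with rfl | hi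
  · simp only [if_true, mul_one, Function.iterate_zero, id_eq]
    have := hA 0 (by simpa using hij)
    simp only [Function.iterate_zero, id_eq] at this
    unfold wkSupC; nlinarith
  rw [if_neg (by omega)]
  have hA1 := hA 1 (by omega)
  have hi4 : i ≤ 4 := by omega
  interval_cases i
  · -- `i = 1`: `D_θ g = q·Ag`
    rw [Function.iterate_one, Dθ_one_eq hα hp]
    rw [abs_mul, abs_of_nonneg hq0]
    calc q * |angOpW α g p.1 p.2| ≤ q * K := mul_le_mul_of_nonneg_left (by simpa using hA1) hq0
      _ ≤ 148 * q * K := by nlinarith [mul_nonneg hq0 hK0]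
      _ = wkSupC * q * M := by simp only [hK, wkSupC]; ring
  · -- `i = 2`
    have hA2 := hA 2 (by omega)
    rw [Dθ_two_eq hα hgs hp]
    have e1 : |2 * s * c * angOpW α g p.1 p.2| ≤ 2 * q * K := by
      rw [abs_mul]
      have : |2 * s * c| ≤ 2 * q := by
        rw [abs_mul, abs_mul, abs_two, abs_of_pos hs]; nlinarith [abs_nonneg c]
      exact mul_le_mul this (by simpa using hA1) (abs_nonneg _) (by positivity)
    have e2 : |q ^ 2 * ((angOpW α)^[2] g) p.1 p.2| ≤ 2 * q * K := by
      rw [abs_mul, abs_of_nonneg (by positivity)]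
      exact mul_le_mul (by nlinarith) hA2 (abs_nonneg _) (by positivity)
    calc _ ≤ |2 * s * c * angOpW α g p.1 p.2| + |q ^ 2 * ((angOpW α)^[2] g) p.1 p.2| := abs_add_le _ _
      _ ≤ 2 * q * K + 2 * q * K := add_le_add e1 e2
      _ ≤ 148 * q * K := by nlinarith [mul_nonneg hq0 hK0]
      _ = wkSupC * q * M := by simp only [hK, wkSupC]; ring
  · -- `i = 3`
    have hA2 := hA 2 (by omega)
    have hA3 := hA 3 (by omega)
    rw [Dθ_three_eq hα hgs hp]
    have e1 : |(4 * s * c ^ 2 - 4 * s ^ 3) * angOpW α g p.1 p.2| ≤ 8 * q * K := by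
      rw [abs_mul]
      have : |4 * s * c ^ 2 - 4 * s ^ 3| ≤ 8 * q := by
        have hc2 : c ^ 2 ≤ 1 := by nlinarith [abs_nonneg c, sq_abs c]
        have t1 : |4 * s * c ^ 2| ≤ 4 * q := by
          rw [abs_of_nonneg (by positivity)]; nlinarith [mul_nonneg hs.le (sub_nonneg.2 hc2)]
        have t2 : |4 * s ^ 3| ≤ 4 * q := by
          rw [abs_of_nonneg (by positivity)]
          have : s ^ 3 ≤ s := by nlinarith [sq_nonneg s, mul_nonneg hs.le (sub_nonneg.2 hs1)]
          linarith
        exact (abs_sub _ _).trans (by linarith)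
      exact mul_le_mul this (by simpa using hA1) (abs_nonneg _) (by positivity)
    have e2 : |6 * s * c * q * ((angOpW α)^[2] g) p.1 p.2| ≤ 6 * q * K := by
      rw [abs_mul]
      have : |6 * s * c * q| ≤ 6 * q := by
        rw [abs_mul, abs_mul, abs_mul, abs_of_pos hs, abs_of_nonneg hq0, show |(6:ℝ)| = 6 by norm_num]
        have hsc : s * |c| ≤ 1 := mul_le_one₀ hs1 (abs_nonneg c) hc1
        nlinarith [mul_nonneg (sub_nonneg.2 hsc) hq0, mul_nonneg hs.le (abs_nonneg c)]
      exact mul_le_mul this hA2 (abs_nonneg _) (by positivity)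
    have e3 : |q ^ 3 * ((angOpW α)^[3] g) p.1 p.2| ≤ 4 * q * K := by
      rw [abs_mul, abs_of_nonneg (by positivity)]
      have hq3 : q ^ 3 ≤ 4 * q := by nlinarith [mul_nonneg (mul_nonneg hq0 (sub_nonneg.2 hq2)) (by linarith : (0:ℝ) ≤ q + 2)]
      exact mul_le_mul hq3 hA3 (abs_nonneg _) (by positivity)
    calc _ ≤ |(4 * s * c ^ 2 - 4 * s ^ 3) * angOpW α g p.1 p.2| + |6 * s * c * q * ((angOpW α)^[2] g) p.1 p.2| +
          |q ^ 3 * ((angOpW α)^[3] g) p.1 p.2| := abs_add_three _ _ _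
      _ ≤ 8 * q * K + 6 * q * K + 4 * q * K := add_le_add (add_le_add e1 e2) e3
      _ ≤ 148 * q * K := by nlinarith [mul_nonneg hq0 hK0]
      _ = wkSupC * q * M := by simp only [hK, wkSupC]; ring
  · -- `i = 4`
    have hA2 := hA 2 (by omega)
    have hA3 := hA 3 (by omega)
    have hA4 := hA 4 (by omega)
    rw [Dθ_four_eq hα hgs hp]
    have hc2 : c ^ 2 ≤ 1 := by nlinarith [abs_nonneg c, sq_abs c]
    have hcabs3 : |c| ^ 3 ≤ 1 := by nlinarith [abs_nonneg c, sq_abs c]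
    have e1 : |(8 * s * c ^ 3 - 40 * s ^ 3 * c) * angOpW α g p.1 p.2| ≤ 48 * q * K := by
      rw [abs_mul]
      have : |8 * s * c ^ 3 - 40 * s ^ 3 * c| ≤ 48 * q := by
        calc |8 * s * c ^ 3 - 40 * s ^ 3 * c| ≤ |8 * s * c ^ 3| + |40 * s ^ 3 * c| := abs_sub _ _
          _ = 8 * s * |c| ^ 3 + 40 * s ^ 3 * |c| := by
              rw [abs_mul, abs_mul, abs_mul, abs_mul, abs_pow, abs_pow, abs_of_pos hs, show |(8:ℝ)| = 8 by norm_num,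
                show |(40:ℝ)| = 40 by norm_num]
          _ ≤ 8 * s + 40 * s := by
              have h3 : s ^ 3 ≤ s := by nlinarith [sq_nonneg s]
              nlinarith [abs_nonneg c, mul_nonneg (pow_nonneg hs.le 3) (abs_nonneg c)]
          _ ≤ 48 * q := by nlinarith
      exact mul_le_mul this (by simpa using hA1) (abs_nonneg _) (by positivity)
    have e2 : |(16 * s * c ^ 2 * q - 16 * s ^ 3 * q + 12 * s ^ 2 * c ^ 2) * ((angOpW α)^[2] g) p.1 p.2| ≤ 44 * q * K := by
      rw [abs_mul]
      have : |16 * s * c ^ 2 * q - 16 * s ^ 3 * q + 12 * s ^ 2 * c ^ 2| ≤ 44 * q := by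
        have t1 : |16 * s * c ^ 2 * q| ≤ 16 * q := by
          rw [abs_of_nonneg (by positivity)]
          have : s * c ^ 2 ≤ 1 := mul_le_one₀ hs1 (sq_nonneg c) hc2
          nlinarith [mul_nonneg (sub_nonneg.2 this) hq0]
        have t2 : |16 * s ^ 3 * q| ≤ 16 * q := by
          rw [abs_of_nonneg (by positivity)]
          have : s ^ 3 ≤ 1 := pow_le_one₀ hs.le hs1
          nlinarith [mul_nonneg (sub_nonneg.2 this) hq0]
        have t3 : |12 * s ^ 2 * c ^ 2| ≤ 12 * q := by
          rw [abs_of_nonneg (by positivity)]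
          have : s ^ 2 * c ^ 2 ≤ s := by nlinarith [mul_nonneg hs.le (sub_nonneg.2 hc2), mul_nonneg (sq_nonneg c) (mul_nonneg hs.le (sub_nonneg.2 hs1))]
          linarith
        calc |16 * s * c ^ 2 * q - 16 * s ^ 3 * q + 12 * s ^ 2 * c ^ 2| ≤ |16 * s * c ^ 2 * q - 16 * s ^ 3 * q| + |12 * s ^ 2 * c ^ 2| := abs_add_le _ _
          _ ≤ |16 * s * c ^ 2 * q| + |16 * s ^ 3 * q| + |12 * s ^ 2 * c ^ 2| := add_le_add_left (abs_sub _ _) _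
          _ ≤ 44 * q := by linarith
      exact mul_le_mul this hA2 (abs_nonneg _) (by positivity)
    have e3 : |12 * s * c * q ^ 2 * ((angOpW α)^[3] g) p.1 p.2| ≤ 48 * q * K := by
      rw [abs_mul]
      have : |12 * s * c * q ^ 2| ≤ 48 * q := by
        rw [abs_mul, abs_mul, abs_mul, abs_of_pos hs, abs_of_nonneg (by positivity : (0:ℝ) ≤ q ^ 2), show |(12:ℝ)| = 12 by norm_num]
        have hsc : s * |c| ≤ 1 := mul_le_one₀ hs1 (abs_nonneg c) hc1
        have hq2' : q ^ 2 ≤ 2 * q := by nlinarith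
        calc 12 * s * |c| * q ^ 2 = 12 * (s * |c|) * q ^ 2 := by ring
          _ ≤ 12 * 1 * q ^ 2 := by gcongr
          _ ≤ 12 * 1 * (2 * q) := by gcongr
          _ ≤ 48 * q := by linarith
      exact mul_le_mul this hA3 (abs_nonneg _) (by positivity)
    have e4 : |q ^ 4 * ((angOpW α)^[4] g) p.1 p.2| ≤ 8 * q * K := by
      rw [abs_mul, abs_of_nonneg (by positivity)]
      have hq4 : q ^ 4 ≤ 8 * q := by
        have h8 : q ^ 3 ≤ 8 := (pow_le_pow_left₀ hq0 hq2 3).trans (by norm_num)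
        calc q ^ 4 = q * q ^ 3 := by ring
          _ ≤ q * 8 := mul_le_mul_of_nonneg_left h8 hq0
          _ = 8 * q := by ring
      exact mul_le_mul hq4 hA4 (abs_nonneg _) (by positivity)
    calc _ ≤ |(8 * s * c ^ 3 - 40 * s ^ 3 * c) * angOpW α g p.1 p.2| +
          |(16 * s * c ^ 2 * q - 16 * s ^ 3 * q + 12 * s ^ 2 * c ^ 2) * ((angOpW α)^[2] g) p.1 p.2| +
          |12 * s * c * q ^ 2 * ((angOpW α)^[3] g) p.1 p.2| + |q ^ 4 * ((angOpW α)^[4] g) p.1 p.2| := abs_add_four_le' _ _ _ _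
      _ ≤ 48 * q * K + 44 * q * K + 48 * q * K + 8 * q * K := add_le_add (add_le_add (add_le_add e1 e2) e3) e4
      _ = wkSupC * q * M := by simp only [hK, wkSupC]; ring

end Elgindi

end Literature.Analysis.FluidPDE
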